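import Summits.Parity.BatemanHorn.Theorems.SelbergDelangeRigidityLSDRealSegmentTailsTwoBalQ
import Summits.Parity.BatemanHorn.Theorems.SelbergDelangeRigidityLSDRealSegmentTailsTwoTop
import Summits.Parity.BatemanHorn.Theorems.SelbergDelangeRigidityLSDRealSegmentTailsTwoRankin
import HarnessLib

/-!
# Route `SelbergDelangeRigidity`, crux `LSDRealSegment` (stmt-Parity-9770), line
# `product-anatomy-subcritical`: clause (d) and the conditional form of `stub_tailsTwo`

* `tailsTwo_balancedClassBound_of_facts` (registered helper): clause (d), `BalancedClassBound k f y`, for every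
  Bateman–Horn system of total degree `2` and `1 ≤ y < 2` — for ONE QUADRATIC by `tailsTwo_balanced_quadratic`; for a
  LINEAR PAIR the balanced class lies inside the top class (a prime `> x^{1−δ}` divides some linear member), so clause (c)
  applies with `η = δ`.
* `stub_tailsTwo_of_facts` (registered helper): THE CONDITIONAL FORM OF THE STUB — assuming the named facts (NT)
  `Literature.NumberTheory.Sieve.NairTenenbaum1998_theorem1` and (R)
  `Literature.NumberTheory.DiophantineApproximation.BugeaudEvertseGyory2018_SPartPolynomialValues`, all four tail clauses
  `APrioriBound`, `RankinTail`, `TopClassBound`, `BalancedClassBound` hold for every Bateman–Horn system of total degree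
  `2` (one irreducible quadratic, or a pair of linear forms) and every `1 ≤ y < 2`.  Both facts are genuinely used, for the
  pair as well: without the `p`-adic Roth input a single `n ≤ x` with `∏ fᵢ(n)` too smooth would break the a priori bound
  for `y` close to `2` (cf. `Negative/NoSpikes`).
-/

open Filter Finset Polynomial
open scoped BigOperators Topology Classical

namespace Summit.Parity.BatemanHorn.Cruxes.LSDRealSegment.ProductAnatomySubcritical

open Literature.NumberTheory.Sieve
open Literature.NumberTheory.DiophantineApproximation
open ArithmeticFunction (cardFactors)
noncomputable section

variable {k : ℕ}

/-- For a linear pair the balanced class lies inside the top class: a prime `> x^{1−δ}` dividing `P(n) = f₁(n) f₂(n)` divides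
some linear member. [folklore] -/
theorem balanced_subset_top_of_linear {f : Fin k → ℤ[X]} (hlin : ∀ i, (f i).natDegree = 1) (x : ℕ) (δ : ℝ) :
    (Finset.Icc 1 x).filter (fun n : ℕ => ∃ p ∈ (prodVal f n).primeFactors, ∃ q ∈ (prodVal f n).primeFactors,
        p ≠ q ∧ (x : ℝ) ^ (1 - δ) < (p : ℝ) ∧ (x : ℝ) ^ (1 - δ) < (q : ℝ)) ⊆
      (Finset.Icc 1 x).filter (fun n : ℕ => ∃ i, ∃ p ∈ (val f i n).primeFactors,
        (x : ℝ) ^ (((f i).natDegree : ℝ) - δ) < (p : ℝ)) := by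
  intro n hn
  rw [Finset.mem_filter] at hn ⊢
  obtain ⟨hn1, p, hp, -, -, -, hxp, -⟩ := hn
  refine ⟨hn1, ?_⟩
  have hp' := Nat.prime_of_mem_primeFactors hp
  have hdvd : p ∣ ∏ i, val f i n := Nat.dvd_of_mem_primeFactors hp
  obtain ⟨i, -, hi⟩ := (Nat.Prime.prime hp').dvd_finsetProd_iff _ |>.mp hdvd
  refine ⟨i, p, Nat.mem_primeFactors.mpr ⟨hp', hi, by rw [val]; positivity⟩, ?_⟩
  rw [hlin i, Nat.cast_one]; exact hxp

/-- **tailsTwo_balancedClassBound_of_facts** (registered helper of `stub_tailsTwo`, line `product-anatomy-subcritical`;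
CONDITIONAL on the named facts `NairTenenbaum1998_theorem1` and `BugeaudEvertseGyory2018_SPartPolynomialValues`):
clause (d) of `stub_tailsTwo` — `BalancedClassBound k f y` for every Bateman–Horn system of total degree `2` and every
`1 ≤ y < 2`. [folklore] -/
theorem tailsTwo_balancedClassBound_of_facts : NairTenenbaum1998_theorem1 → BugeaudEvertseGyory2018_SPartPolynomialValues →
    ∀ (k : ℕ) (f : Fin k → ℤ[X]), IsBatemanHornSystem f → (∑ i, (f i).natDegree) = 2 →
    ∀ y : ℝ, 1 ≤ y → y < 2 → BalancedClassBound k f y := by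
  intro hNT hBEG k f hf hdeg y hy hy2
  rcases eq_one_or_two_of_sum_natDegree hf hdeg with hk | hk
  · exact tailsTwo_balanced_quadratic hNT hBEG k f hf hdeg hk y hy hy2
  · -- a linear pair: every member has degree `1`
    have hlin : ∀ i, (f i).natDegree = 1 := by
      subst hk
      intro i
      have h0 := hf.natDegree_pos 0
      have h1 := hf.natDegree_pos 1
      rw [Fin.sum_univ_two] at hdeg
      fin_cases i <;> simp <;> omega
    intro ε hε
    obtain ⟨η, hη, hev⟩ := tailsTwo_topClassBound_of_facts hNT hBEG k f hf hdeg y hy hy2 ε hε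
    refine ⟨η, hη, ?_⟩
    filter_upwards [hev] with x hx
    exact le_trans (Finset.sum_le_sum_of_subset_of_nonneg (balanced_subset_top_of_linear hlin x η) fun n _ _ => by positivity) hx

/-- **stub_tailsTwo_of_facts** (registered helper of `stub_tailsTwo`, line `product-anatomy-subcritical`; THE CONDITIONAL FORM
OF THE STUB): assuming the named facts (NT) `NairTenenbaum1998_theorem1` (Nair–Tenenbaum 1998, Thm 1) and (R)
`BugeaudEvertseGyory2018_SPartPolynomialValues` (Bugeaud–Evertse–Győry 2018, Thm 2.1 (i): `p`-adic Thue–Siegel–Roth), all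
four tail clauses of `stub_tailsTwo` hold for every Bateman–Horn system of total degree `2` and every `1 ≤ y < 2`. [folklore] -/
theorem stub_tailsTwo_of_facts : NairTenenbaum1998_theorem1 → BugeaudEvertseGyory2018_SPartPolynomialValues →
    ∀ (k : ℕ) (f : Fin k → ℤ[X]), IsBatemanHornSystem f → (∑ i, (f i).natDegree) = 2 → ∀ y : ℝ, 1 ≤ y → y < 2 →
      APrioriBound k f y ∧ RankinTail k f y ∧ TopClassBound k f y ∧ BalancedClassBound k f y :=
  fun hNT hBEG k f hf hdeg y hy hy2 =>
    ⟨tailsTwo_aPrioriBound_of_facts hNT hBEG k f hf hdeg y hy hy2, tailsTwo_rankinTail_of_facts hNT hBEG k f hf hdeg y hy hy2,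
      tailsTwo_topClassBound_of_facts hNT hBEG k f hf hdeg y hy hy2, tailsTwo_balancedClassBound_of_facts hNT hBEG k f hf hdeg y hy hy2⟩

end

end Summit.Parity.BatemanHorn.Cruxes.LSDRealSegment.ProductAnatomySubcritical
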